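import Mathlib
import HarnessLib

/-!
# Route RootDecompLitSlice — cell Uᶜ `CritTameScarIsCritical` (stmt-NavierStokesRegularity-31733):
# the LAGGED endpoint closure, abstract part — invariant interval of the two-level one-step map and the
# lagged bootstrap (Mathlib-only)

Helper toward Uᶜ (`--supports 31733`, no item, no node; census instrument decomp-ns-census-1 g58, tree probe
#53, file 1 of 2; the frame theorem and the cell form are in `RootDecompLitSliceMeanFieldLaggedEndpoint`).

THE POINT (paper-level reading of the decomp-ns writer's ENDPOINT ANATOMY, HOME/writer/g43/NOTES-g43.md,
`RootDecompLitSliceMeanFieldEndpoint` p837169; critic rows 726/730). At the endpoint `a = 1/2` of the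
mean-field bootstrap (proxy window `σ = mτ`) the closing functional for the SINGLE unknown `g = sup D/√τ`,
`g ≤ K(1+2m^{1/4}) + m^{−1/4}g + cK^{1/4}ν^{−5/4}(m^{−1/8}+m^{−1/4})g^{5/4}`, is superlinear. The same
one-step estimate, read as a bound of the WINDOW level `φ₁ = D(t)/√(T−t)` by the PROXY level
`φ₀ = D(s)/√(T−s)` at the lagged time `s = T − mτ`, is
`φ₁ ≤ A(1+m^{1/4}) + Bm^{−1/4}φ₀^{1/2}φ₁^{1/2} + c m^{−1/8}φ₀^{1/2}φ₁^{3/4} + c m^{−1/4}φ₀^{3/4}φ₁^{1/2}`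
(on the diagonal `φ₀ = φ₁ = g` this is the functional above: `rhs_diag`): every power of the UNKNOWN `φ₁`
is `< 1`, the excess `1/4` of homogeneity sits on the KNOWN lagged level. Hence an INVARIANT INTERVAL
`[0, X]` (`quartic_invariant`, `rpow_invariant`: `φ₀ ≤ X ⟹ φ₁ ≤ X` once `Bm^{−1/4} ≤ 1/4`,
`c m^{−1/8}X^{1/4} ≤ 1/4`, `c m^{−1/4}X^{1/4} ≤ 1/4`, `4A(1+m^{1/4}) ≤ X`), and the LAGGED BOOTSTRAP
`closure_of_laggedStep`: an antitone `D` that starts below `X√(T−t₀)` and whose level is preserved along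
`T − s = m(T − t)` obeys `D ≤ X√m·√(T−t)` on `[t₀, T)` — with NO a-priori bound near `T`.

All statements def-free, standard axioms; pure real analysis (no Navier–Stokes object). Rung 0: nothing here
proves NS regularity. [folklore]
-/

set_option linter.dupNamespace false

namespace Summit.NavierStokesRegularity.NavierStokesRegularity.Theorems

open Set

namespace MeanFieldLaggedClosure

/-! ## §1 The invariant interval of the two-level one-step map -/

/-- **Invariant interval, quartic form.** With `x = φ₀^{1/4}`, `y = φ₁^{1/4}`, `Z = X^{1/4}`: if
`y⁴ ≤ A + q x²y² + c₁ x²y³ + c₂ x³y²`, `x ≤ Z`, and the level `Z` satisfies `q ≤ 1/4`, `c₁Z ≤ 1/4`,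
`c₂Z ≤ 1/4`, `4A ≤ Z⁴`, then `y ≤ Z`: were `y > Z`, each monomial would be at most `y⁴` resp. `Z·y⁴`, so
`y⁴ ≤ A + (3/4)y⁴`, `y⁴ ≤ 4A ≤ Z⁴`. [folklore] -/
theorem quartic_invariant {A q c₁ c₂ Z x y : ℝ} (hq : 0 ≤ q) (hc₁ : 0 ≤ c₁) (hc₂ : 0 ≤ c₂)
    (hZ : 0 ≤ Z) (hx : 0 ≤ x) (hy : 0 ≤ y)
    (hq' : q ≤ 1 / 4) (hc₁' : c₁ * Z ≤ 1 / 4) (hc₂' : c₂ * Z ≤ 1 / 4) (hAZ : 4 * A ≤ Z ^ 4)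
    (hxZ : x ≤ Z)
    (h : y ^ 4 ≤ A + q * (x ^ 2 * y ^ 2) + c₁ * (x ^ 2 * y ^ 3) + c₂ * (x ^ 3 * y ^ 2)) :
    y ≤ Z := by
  by_contra hyZ'
  have hyZ : Z < y := not_le.1 hyZ'
  have hxy : x ≤ y := hxZ.trans hyZ.le
  have hy2 : 0 ≤ y ^ 2 := pow_nonneg hy 2
  have hy3 : 0 ≤ y ^ 3 := pow_nonneg hy 3
  have hy4 : 0 ≤ y ^ 4 := pow_nonneg hy 4
  have hx2 : x ^ 2 ≤ Z ^ 2 := pow_le_pow_left₀ hx hxZ 2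
  have hx3 : x ^ 3 ≤ Z ^ 3 := pow_le_pow_left₀ hx hxZ 3
  have hZy : Z ≤ y := hyZ.le
  have hZ2 : Z ^ 2 ≤ y ^ 2 := pow_le_pow_left₀ hZ hZy 2
  -- monomial bounds above the level
  have h1 : x ^ 2 * y ^ 2 ≤ y ^ 4 := by
    have e : x ^ 2 * y ^ 2 ≤ y ^ 2 * y ^ 2 :=
      mul_le_mul_of_nonneg_right (hx2.trans hZ2) hy2
    calc x ^ 2 * y ^ 2 ≤ y ^ 2 * y ^ 2 := e
      _ = y ^ 4 := by ring
  have h2 : x ^ 2 * y ^ 3 ≤ Z * y ^ 4 := by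
    have e1 : x ^ 2 * y ^ 3 ≤ Z ^ 2 * y ^ 3 := mul_le_mul_of_nonneg_right hx2 hy3
    have e2 : Z * y ^ 3 ≤ y * y ^ 3 := mul_le_mul_of_nonneg_right hZy hy3
    have e3 : Z ^ 2 * y ^ 3 = Z * (Z * y ^ 3) := by ring
    have e4 : Z * (Z * y ^ 3) ≤ Z * (y * y ^ 3) := mul_le_mul_of_nonneg_left e2 hZ
    calc x ^ 2 * y ^ 3 ≤ Z ^ 2 * y ^ 3 := e1
      _ = Z * (Z * y ^ 3) := e3
      _ ≤ Z * (y * y ^ 3) := e4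
      _ = Z * y ^ 4 := by ring
  have h3 : x ^ 3 * y ^ 2 ≤ Z * y ^ 4 := by
    have e1 : x ^ 3 * y ^ 2 ≤ Z ^ 3 * y ^ 2 := mul_le_mul_of_nonneg_right hx3 hy2
    have e3 : Z ^ 3 * y ^ 2 = Z * (Z ^ 2 * y ^ 2) := by ring
    have e4 : Z * (Z ^ 2 * y ^ 2) ≤ Z * (y ^ 2 * y ^ 2) :=
      mul_le_mul_of_nonneg_left (mul_le_mul_of_nonneg_right hZ2 hy2) hZ
    calc x ^ 3 * y ^ 2 ≤ Z ^ 3 * y ^ 2 := e1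
      _ = Z * (Z ^ 2 * y ^ 2) := e3
      _ ≤ Z * (y ^ 2 * y ^ 2) := e4
      _ = Z * y ^ 4 := by ring
  have e1 := mul_le_mul_of_nonneg_left h1 hq
  have e2 := mul_le_mul_of_nonneg_left h2 hc₁
  have e3 := mul_le_mul_of_nonneg_left h3 hc₂
  have hsum : y ^ 4 ≤ A + (q + c₁ * Z + c₂ * Z) * y ^ 4 := by
    have : q * (x ^ 2 * y ^ 2) + c₁ * (x ^ 2 * y ^ 3) + c₂ * (x ^ 3 * y ^ 2)
        ≤ q * y ^ 4 + c₁ * (Z * y ^ 4) + c₂ * (Z * y ^ 4) := by linarith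
    calc y ^ 4 ≤ A + q * (x ^ 2 * y ^ 2) + c₁ * (x ^ 2 * y ^ 3) + c₂ * (x ^ 3 * y ^ 2) := h
      _ ≤ A + (q * y ^ 4 + c₁ * (Z * y ^ 4) + c₂ * (Z * y ^ 4)) := by linarith
      _ = A + (q + c₁ * Z + c₂ * Z) * y ^ 4 := by ring
  have hcoef : (q + c₁ * Z + c₂ * Z) * y ^ 4 ≤ (3 / 4) * y ^ 4 :=
    mul_le_mul_of_nonneg_right (by linarith) hy4
  have hy4A : y ^ 4 ≤ Z ^ 4 := by linarith
  have : y ≤ Z := (pow_le_pow_iff_left₀ hy hZ (by norm_num)).1 hy4A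
  exact hyZ' this

/-- **Invariant interval of the two-level one-step map** (φ-currency, real powers). If the window level
`φ₁ ≥ 0` obeys the endpoint one-step bound against the proxy level `φ₀ ≥ 0`,
`φ₁ ≤ A + q φ₀^{1/2}φ₁^{1/2} + c₁ φ₀^{1/2}φ₁^{3/4} + c₂ φ₀^{3/4}φ₁^{1/2}`, with `φ₀ ≤ X` and a level `X ≥ 0`
such that `q ≤ 1/4`, `c₁X^{1/4} ≤ 1/4`, `c₂X^{1/4} ≤ 1/4`, `4A ≤ X`, then `φ₁ ≤ X`. (Every power of the
UNKNOWN `φ₁` is `< 1`; `quartic_invariant` after fourth roots.) [folklore] -/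
theorem rpow_invariant {A q c₁ c₂ X φ₀ φ₁ : ℝ} (hq : 0 ≤ q) (hc₁ : 0 ≤ c₁) (hc₂ : 0 ≤ c₂)
    (hX : 0 ≤ X) (hφ₀ : 0 ≤ φ₀) (hφ₁ : 0 ≤ φ₁)
    (hq' : q ≤ 1 / 4) (hc₁' : c₁ * X ^ (1 / 4 : ℝ) ≤ 1 / 4) (hc₂' : c₂ * X ^ (1 / 4 : ℝ) ≤ 1 / 4)
    (hAX : 4 * A ≤ X) (h₀ : φ₀ ≤ X)
    (h : φ₁ ≤ A + q * (φ₀ ^ (1 / 2 : ℝ) * φ₁ ^ (1 / 2 : ℝ))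
        + c₁ * (φ₀ ^ (1 / 2 : ℝ) * φ₁ ^ (3 / 4 : ℝ)) + c₂ * (φ₀ ^ (3 / 4 : ℝ) * φ₁ ^ (1 / 2 : ℝ))) :
    φ₁ ≤ X := by
  have ex4 : (φ₀ ^ (1 / 4 : ℝ)) ^ 4 = φ₀ := by
    rw [← Real.rpow_mul_natCast hφ₀]; norm_num
  have ey4 : (φ₁ ^ (1 / 4 : ℝ)) ^ 4 = φ₁ := by
    rw [← Real.rpow_mul_natCast hφ₁]; norm_num
  have eZ4 : (X ^ (1 / 4 : ℝ)) ^ 4 = X := by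
    rw [← Real.rpow_mul_natCast hX]; norm_num
  have ex2 : φ₀ ^ (1 / 2 : ℝ) = (φ₀ ^ (1 / 4 : ℝ)) ^ 2 := by
    rw [← Real.rpow_mul_natCast hφ₀]; norm_num
  have ex3 : φ₀ ^ (3 / 4 : ℝ) = (φ₀ ^ (1 / 4 : ℝ)) ^ 3 := by
    rw [← Real.rpow_mul_natCast hφ₀]; norm_num
  have ey2 : φ₁ ^ (1 / 2 : ℝ) = (φ₁ ^ (1 / 4 : ℝ)) ^ 2 := by
    rw [← Real.rpow_mul_natCast hφ₁]; norm_num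
  have ey3 : φ₁ ^ (3 / 4 : ℝ) = (φ₁ ^ (1 / 4 : ℝ)) ^ 3 := by
    rw [← Real.rpow_mul_natCast hφ₁]; norm_num
  have hx : 0 ≤ φ₀ ^ (1 / 4 : ℝ) := Real.rpow_nonneg hφ₀ _
  have hy : 0 ≤ φ₁ ^ (1 / 4 : ℝ) := Real.rpow_nonneg hφ₁ _
  have hZ : 0 ≤ X ^ (1 / 4 : ℝ) := Real.rpow_nonneg hX _
  have hxZ : φ₀ ^ (1 / 4 : ℝ) ≤ X ^ (1 / 4 : ℝ) := Real.rpow_le_rpow hφ₀ h₀ (by norm_num)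
  have hAZ : 4 * A ≤ (X ^ (1 / 4 : ℝ)) ^ 4 := by rw [eZ4]; exact hAX
  have h' : (φ₁ ^ (1 / 4 : ℝ)) ^ 4 ≤ A + q * ((φ₀ ^ (1 / 4 : ℝ)) ^ 2 * (φ₁ ^ (1 / 4 : ℝ)) ^ 2)
      + c₁ * ((φ₀ ^ (1 / 4 : ℝ)) ^ 2 * (φ₁ ^ (1 / 4 : ℝ)) ^ 3)
      + c₂ * ((φ₀ ^ (1 / 4 : ℝ)) ^ 3 * (φ₁ ^ (1 / 4 : ℝ)) ^ 2) := by
    rw [ey4, ← ex2, ← ex3, ← ey2, ← ey3]; exact h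
  have hyZ := quartic_invariant hq hc₁ hc₂ hZ hx hy hq' hc₁' hc₂' hAZ hxZ h'
  calc φ₁ = (φ₁ ^ (1 / 4 : ℝ)) ^ 4 := ey4.symm
    _ ≤ (X ^ (1 / 4 : ℝ)) ^ 4 := pow_le_pow_left₀ hy hyZ 4
    _ = X := eZ4

/-- **On the diagonal the two-level bound is the writer's endpoint functional**: for `g ≥ 0`,
`g^{1/2}g^{1/2} = g` and `g^{1/2}g^{3/4} = g^{3/4}g^{1/2} = g^{5/4}`, so with `φ₀ = φ₁ = g` the
antecedent's right-hand side is `A(1+m^{1/4}) + (B/m^{1/4})g + c(m^{−1/8}+m^{−1/4})g^{5/4}`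
(HOME/writer/g43/NOTES-g43.md §ENDPOINT, critic row 726). [folklore] -/
theorem rhs_diag {A B c m g : ℝ} (hg : 0 ≤ g) :
    A * (1 + m ^ (1 / 4 : ℝ)) + B / m ^ (1 / 4 : ℝ) * (g ^ (1 / 2 : ℝ) * g ^ (1 / 2 : ℝ))
      + c / m ^ (1 / 8 : ℝ) * (g ^ (1 / 2 : ℝ) * g ^ (3 / 4 : ℝ))
      + c / m ^ (1 / 4 : ℝ) * (g ^ (3 / 4 : ℝ) * g ^ (1 / 2 : ℝ))
    = A * (1 + m ^ (1 / 4 : ℝ)) + B / m ^ (1 / 4 : ℝ) * g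
      + c * (1 / m ^ (1 / 8 : ℝ) + 1 / m ^ (1 / 4 : ℝ)) * g ^ (5 / 4 : ℝ) := by
  have e1 : g ^ (1 / 2 : ℝ) * g ^ (1 / 2 : ℝ) = g := by
    rw [← Real.rpow_add' hg (by norm_num)]; norm_num
  have e2 : g ^ (1 / 2 : ℝ) * g ^ (3 / 4 : ℝ) = g ^ (5 / 4 : ℝ) := by
    rw [← Real.rpow_add' hg (by norm_num)]; norm_num
  have e3 : g ^ (3 / 4 : ℝ) * g ^ (1 / 2 : ℝ) = g ^ (5 / 4 : ℝ) := by
    rw [← Real.rpow_add' hg (by norm_num)]; norm_num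
  rw [e1, e2, e3]; ring

/-! ## §2 The abstract lagged bootstrap -/

/-- ★ **Lagged bootstrap** (abstract). Let `D` be non-increasing on `[t₀, T)`, `D(t₀) ≤ X√(T−t₀)` with
`X ≥ 0`, `m > 1`, and suppose the STEP: for `t₀ ≤ s < t < T` with `T − s = m(T − t)`,
`D(s) ≤ X√(T−s) ⟹ D(t) ≤ X√(T−t)`. Then `D(t) ≤ X√m·√(T−t)` on `[t₀, T)`: induction along the geometric
chain `sₖ = T − (T−t₀)m^{−k}` (which starts at `t₀`), then `D(t) ≤ D(sₖ) ≤ X√(T−sₖ) ≤ X√m√(T−t)` for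
`sₖ ≤ t ≤ sₖ₊₁` by monotonicity. No a-priori bound on `D(t)/√(T−t)` near `T` is used. [folklore] -/
theorem closure_of_laggedStep {T t₀ m X : ℝ} {D : ℝ → ℝ} (ht₀ : t₀ < T) (hm : 1 < m) (hX : 0 ≤ X)
    (hanti : ∀ s t : ℝ, t₀ ≤ s → s ≤ t → t < T → D t ≤ D s)
    (hstart : D t₀ ≤ X * Real.sqrt (T - t₀))
    (hstep : ∀ s t : ℝ, t₀ ≤ s → s < t → t < T → T - s = m * (T - t) →
      D s ≤ X * Real.sqrt (T - s) → D t ≤ X * Real.sqrt (T - t)) :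
    ∀ t ∈ Ico t₀ T, D t ≤ X * Real.sqrt m * Real.sqrt (T - t) := by
  have hτ₀pos : 0 < T - t₀ := by linarith
  have hm0 : 0 < m := by linarith
  have hr0 : 0 < m⁻¹ := inv_pos.2 hm0
  have hr1 : m⁻¹ < 1 := inv_lt_one_of_one_lt₀ hm
  have hmr : m * m⁻¹ = 1 := mul_inv_cancel₀ hm0.ne'
  have hsqm : 1 ≤ Real.sqrt m := by
    rw [← Real.sqrt_one]; exact Real.sqrt_le_sqrt hm.le
  have hscale : ∀ k : ℕ, (T - t₀) * m⁻¹ ^ k = m * ((T - t₀) * m⁻¹ ^ (k + 1)) := by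
    intro k
    rw [pow_succ, show m * ((T - t₀) * (m⁻¹ ^ k * m⁻¹)) = (T - t₀) * m⁻¹ ^ k * (m * m⁻¹) by ring,
      hmr, mul_one]
  -- the geometric chain
  have chain : ∀ k : ℕ, D (T - (T - t₀) * m⁻¹ ^ k) ≤ X * Real.sqrt ((T - t₀) * m⁻¹ ^ k) := by
    intro k
    induction k with
    | zero => simpa only [pow_zero, mul_one, sub_sub_cancel] using hstart
    | succ k ih =>
      have hpk : 0 < m⁻¹ ^ k := pow_pos hr0 k
      have hpk1 : m⁻¹ ^ k ≤ 1 := pow_le_one₀ hr0.le hr1.le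
      have hs : t₀ ≤ T - (T - t₀) * m⁻¹ ^ k := by
        nlinarith [mul_nonneg hτ₀pos.le (sub_nonneg.2 hpk1)]
      have hlt : (T - t₀) * m⁻¹ ^ (k + 1) < (T - t₀) * m⁻¹ ^ k := by
        have h1 : (T - t₀) * m⁻¹ ^ k * m⁻¹ < (T - t₀) * m⁻¹ ^ k * 1 :=
          mul_lt_mul_of_pos_left hr1 (mul_pos hτ₀pos hpk)
        rw [mul_one] at h1
        calc (T - t₀) * m⁻¹ ^ (k + 1) = (T - t₀) * m⁻¹ ^ k * m⁻¹ := by rw [pow_succ]; ring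
          _ < (T - t₀) * m⁻¹ ^ k := h1
      have hst : T - (T - t₀) * m⁻¹ ^ k < T - (T - t₀) * m⁻¹ ^ (k + 1) := by linarith
      have htT : T - (T - t₀) * m⁻¹ ^ (k + 1) < T := by
        have := mul_pos hτ₀pos (pow_pos hr0 (k + 1)); linarith
      have hlagEq : T - (T - (T - t₀) * m⁻¹ ^ k) = m * (T - (T - (T - t₀) * m⁻¹ ^ (k + 1))) := by
        rw [sub_sub_cancel, sub_sub_cancel]; exact hscale k
      have ih' : D (T - (T - t₀) * m⁻¹ ^ k) ≤ X * Real.sqrt (T - (T - (T - t₀) * m⁻¹ ^ k)) := by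
        rwa [sub_sub_cancel]
      have := hstep _ _ hs hst htT hlagEq ih'
      rwa [sub_sub_cancel] at this
  -- fill in by monotonicity
  have fill : ∀ n : ℕ, ∀ t ∈ Ico t₀ T, (T - t₀) * m⁻¹ ^ n ≤ T - t →
      D t ≤ X * Real.sqrt m * Real.sqrt (T - t) := by
    intro n
    induction n with
    | zero =>
      intro t ht hτ
      rw [pow_zero, mul_one] at hτ
      have hteq : t = t₀ := le_antisymm (by linarith) ht.1
      rw [hteq]
      have h0 : 0 ≤ X * Real.sqrt (T - t₀) := mul_nonneg hX (Real.sqrt_nonneg _)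
      calc D t₀ ≤ X * Real.sqrt (T - t₀) := hstart
        _ = X * Real.sqrt (T - t₀) * 1 := (mul_one _).symm
        _ ≤ X * Real.sqrt (T - t₀) * Real.sqrt m := mul_le_mul_of_nonneg_left hsqm h0
        _ = X * Real.sqrt m * Real.sqrt (T - t₀) := by ring
    | succ n ih =>
      intro t ht hτ
      rcases le_or_gt ((T - t₀) * m⁻¹ ^ n) (T - t) with h | h
      · exact ih t ht h
      · have hsn := chain n
        have hpn1 : m⁻¹ ^ n ≤ 1 := pow_le_one₀ hr0.le hr1.le
        have hs0 : t₀ ≤ T - (T - t₀) * m⁻¹ ^ n := by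
          nlinarith [mul_nonneg hτ₀pos.le (sub_nonneg.2 hpn1)]
        have hst : T - (T - t₀) * m⁻¹ ^ n ≤ t := by linarith
        have hDt : D t ≤ D (T - (T - t₀) * m⁻¹ ^ n) := hanti _ _ hs0 hst ht.2
        have hsq : Real.sqrt ((T - t₀) * m⁻¹ ^ n) =
            Real.sqrt m * Real.sqrt ((T - t₀) * m⁻¹ ^ (n + 1)) := by
          rw [← Real.sqrt_mul hm0.le, ← hscale n]
        have hmono : Real.sqrt ((T - t₀) * m⁻¹ ^ (n + 1)) ≤ Real.sqrt (T - t) :=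
          Real.sqrt_le_sqrt hτ
        calc D t ≤ D (T - (T - t₀) * m⁻¹ ^ n) := hDt
          _ ≤ X * Real.sqrt ((T - t₀) * m⁻¹ ^ n) := hsn
          _ = X * Real.sqrt m * Real.sqrt ((T - t₀) * m⁻¹ ^ (n + 1)) := by rw [hsq]; ring
          _ ≤ X * Real.sqrt m * Real.sqrt (T - t) :=
            mul_le_mul_of_nonneg_left hmono (mul_nonneg hX (Real.sqrt_nonneg _))
  intro t ht
  have hτpos : 0 < T - t := by linarith [ht.2]
  obtain ⟨n, hn⟩ := exists_pow_lt_of_lt_one (div_pos hτpos hτ₀pos) hr1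
  have hτ : (T - t₀) * m⁻¹ ^ n ≤ T - t := by
    have h1 := (lt_div_iff₀ hτ₀pos).1 hn
    rw [mul_comm] at h1
    exact h1.le
  exact fill n t ht hτ

end MeanFieldLaggedClosure

end Summit.NavierStokesRegularity.NavierStokesRegularity.Theorems
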